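import Mathlib.LinearAlgebra.Matrix.Trace
import Mathlib.LinearAlgebra.Matrix.Notation
import Mathlib.LinearAlgebra.Matrix.Determinant.Basic
import Mathlib.LinearAlgebra.FiniteDimensional.Lemmas
import Mathlib.LinearAlgebra.Dimension.Constructions
import Mathlib.Data.Matrix.Mul
import Mathlib.Tactic.NoncommRing
import Mathlib.Tactic.LinearCombination
import Mathlib.Tactic.FieldSimp
import Mathlib.Algebra.CharP.Algebra
import HarnessLib

/-!
# Open image, IV: Lie subalgebras of `𝔤𝔩₂` not containing `𝔰𝔩₂` have an invariant line (proofs file)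

Pure linear algebra over a field `F` of characteristic `0` (theorems only).  Let
`L ⊆ M₂(F)` be an `F`-subspace closed under the bracket `[X, Y] = XY − YX`.  If `L` does not
contain the three matrices `E = e₁₂`, `F = e₂₁`, `H = e₁₁ − e₂₂` (i.e. `𝔰𝔩₂(F) ⊄ L`), then
there is a nonzero vector `v` with coordinates in any extension field `E ⊇ F` containing the
square roots of all elements of `F` (e.g. an algebraic closure) such that every `X ∈ L` maps
`v` into the line `E v` (`OpenImage.exists_eigenline_of_not_sl2_subset`).  This is the
`2 × 2` Lie-algebra computation behind "`𝔤_ℓ ⊇ 𝔰𝔩₂` unless the Galois image has an invariant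
line on an open subgroup" in the open-image theorem (Serre; Ribet 1977, Thm. (5.7)):

* reduce to trace-free `L' = π(L) ⊆ 𝔰𝔩₂` (`π(X) = X − ½ tr(X)`);
* `L' = 0`: every line; `L' = F X₀`: an eigenvector of `X₀` over `F(√(−det X₀))`
  (`X₀² = −det(X₀) · 1`); `L' = F X₀ ⊕ F Y₀`: then `Z = [X₀, Y₀] ≠ 0` is `ad`-semi-invariant,
  `[X₀, Z] = qZ`, `[Y₀, Z] = −pZ`, which forces `Z² = 0` (else `2qZ² = 0 = 2pZ²` gives `Z = 0`),
  and the kernel line of the nilpotent `Z` is invariant over `F`; three linearly independent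
  trace-free elements span `𝔰𝔩₂` (dimension count), excluded.

## References

* J.-P. Serre, *Abelian ℓ-adic representations and elliptic curves*, Benjamin 1968, Ch. IV,
  and *Lie algebras and Lie groups*, LNM 1500, Part I, Ch. VI (subalgebras of `𝔰𝔩₂`).
  [SerreAbelianLadic1968]
* K. A. Ribet, *Galois representations attached to eigenforms with Nebentypus*, LNM 601 (1977),
  Thm. (5.7) and its proof. [Ribet1977Nebentypus]
-/

namespace Literature.NumberTheory.EllipticCurves.ModularForms

namespace OpenImage

open Matrix

variable {F : Type*} [Field F]

/-! ### `2 × 2` identities -/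

/-- **Cayley–Hamilton for trace-free `2 × 2` matrices**: `X² = −det(X) · 1`. [folklore] -/
theorem mul_self_eq_smul_one_of_trace_eq_zero (X : Matrix (Fin 2) (Fin 2) F) (hX : X.trace = 0) :
    X * X = (-X.det) • (1 : Matrix (Fin 2) (Fin 2) F) := by
  rw [Matrix.trace_fin_two] at hX
  have h11 : X 1 1 = -X 0 0 := by linear_combination hX
  ext i j
  fin_cases i <;> fin_cases j <;>
    simp [Matrix.mul_apply, Fin.sum_univ_two, Matrix.det_fin_two, h11] <;> ring

/-- Commuting trace-free `2 × 2` matrices are proportional (characteristic `≠ 2`). [folklore] -/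
theorem exists_eq_smul_of_commute_of_trace_eq_zero [CharZero F] {X Y : Matrix (Fin 2) (Fin 2) F}
    (hX : X.trace = 0) (hY : Y.trace = 0) (hX0 : X ≠ 0) (h : X * Y = Y * X) : ∃ t : F, Y = t • X := by
  rw [Matrix.trace_fin_two] at hX hY
  have hX11 : X 1 1 = -X 0 0 := by linear_combination hX
  have hY11 : Y 1 1 = -Y 0 0 := by linear_combination hY
  have e00 := congrFun (congrFun h 0) 0
  have e01 := congrFun (congrFun h 0) 1
  have e10 := congrFun (congrFun h 1) 0
  simp only [Matrix.mul_apply, Fin.sum_univ_two, hX11, hY11] at e00 e01 e10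
  -- `b z = y c`, `a y = b x`, `c x = a z` for `X = (a b; c -a)`, `Y = (x y; z -x)`
  have h1 : X 0 1 * Y 1 0 = Y 0 1 * X 1 0 := by linear_combination e00
  have h2 : X 0 0 * Y 0 1 = X 0 1 * Y 0 0 := by
    have : (2 : F) * (X 0 0 * Y 0 1 - X 0 1 * Y 0 0) = 0 := by linear_combination e01
    have h2' : (2 : F) ≠ 0 := two_ne_zero
    have := (mul_eq_zero.1 this).resolve_left h2'
    linear_combination this
  have h3 : X 1 0 * Y 0 0 = X 0 0 * Y 1 0 := by
    have : (2 : F) * (X 1 0 * Y 0 0 - X 0 0 * Y 1 0) = 0 := by linear_combination e10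
    have h2' : (2 : F) ≠ 0 := two_ne_zero
    have := (mul_eq_zero.1 this).resolve_left h2'
    linear_combination this
  have key : ∀ t : F, t * X 0 0 = Y 0 0 → t * X 0 1 = Y 0 1 → t * X 1 0 = Y 1 0 → Y = t • X := by
    intro t ha hb hc
    ext i j
    fin_cases i <;> fin_cases j
    · simpa using ha.symm
    · simpa using hb.symm
    · simpa using hc.symm
    · simp [hX11, hY11]; linear_combination -ha
  by_cases ha : X 0 0 ≠ 0
  · refine ⟨Y 0 0 / X 0 0, key _ ?_ ?_ ?_⟩
    · field_simp
    · field_simp; linear_combination -h2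
    · field_simp; linear_combination h3
  push Not at ha
  by_cases hb : X 0 1 ≠ 0
  · have hx : Y 0 0 = 0 := by
      have : X 0 1 * Y 0 0 = 0 := by rw [← h2, ha, zero_mul]
      exact (mul_eq_zero.1 this).resolve_left hb
    refine ⟨Y 0 1 / X 0 1, key _ ?_ ?_ ?_⟩
    · rw [ha, hx, mul_zero]
    · field_simp
    · field_simp; linear_combination -h1
  push Not at hb
  by_cases hc : X 1 0 ≠ 0
  · have hx : Y 0 0 = 0 := by
      have : X 1 0 * Y 0 0 = 0 := by rw [h3, ha, zero_mul]
      exact (mul_eq_zero.1 this).resolve_left hc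
    have hy : Y 0 1 = 0 := by
      have : Y 0 1 * X 1 0 = 0 := by rw [← h1, hb, zero_mul]
      exact (mul_eq_zero.1 this).resolve_right hc
    refine ⟨Y 1 0 / X 1 0, key _ ?_ ?_ ?_⟩
    · rw [ha, hx, mul_zero]
    · rw [hb, hy, mul_zero]
    · field_simp
  push Not at hc
  exfalso
  apply hX0
  ext i j
  fin_cases i <;> fin_cases j <;> simp [ha, hb, hc, hX11]

/-- A nonzero matrix has a nonzero column. [folklore] -/
theorem exists_col_ne_zero {m n : Type*} {R : Type*} [Zero R] {A : Matrix m n R} (hA : A ≠ 0) :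
    ∃ j, A.col j ≠ 0 := by
  by_contra h
  push Not at h
  apply hA
  ext i j
  have := congrFun (h j) i
  simpa using this

/-- `X *ᵥ (col j of W) = col j of (X * W)`. [folklore] -/
theorem mulVec_col_eq {m : Type*} [Fintype m] {R : Type*} [NonUnitalNonAssocSemiring R]
    (X W : Matrix m m R) (j : m) : X *ᵥ W.col j = (X * W).col j := by
  ext i
  simp [Matrix.mulVec, dotProduct, Matrix.mul_apply]

/-- **Eigenvectors of trace-free `2 × 2` matrices.**  If `tr X = 0`, `X ≠ 0` and `X² = μ² · 1`
then `X` has an eigenvector with eigenvalue `μ`: a nonzero column of `X + μ`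
(characteristic `≠ 2` excludes `X = −μ`). [folklore] -/
theorem exists_mulVec_eq_smul_of_mul_self_eq [CharZero F] {X : Matrix (Fin 2) (Fin 2) F} (hX : X.trace = 0)
    (hX0 : X ≠ 0) {μ : F} (hμ : X * X = (μ * μ) • (1 : Matrix (Fin 2) (Fin 2) F)) :
    ∃ v : Fin 2 → F, v ≠ 0 ∧ X *ᵥ v = μ • v := by
  set W : Matrix (Fin 2) (Fin 2) F := X + μ • 1 with hW
  have hW0 : W ≠ 0 := by
    intro h0
    have hXμ : X = -(μ • (1 : Matrix (Fin 2) (Fin 2) F)) := eq_neg_of_add_eq_zero_left h0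
    have htr : X.trace + 2 * μ = 0 := by
      rw [hXμ, Matrix.trace_neg, Matrix.trace_smul, Matrix.trace_one, Fintype.card_fin, smul_eq_mul]
      push_cast
      ring
    rw [hX, zero_add] at htr
    have hμ0 : μ = 0 := (mul_eq_zero.1 htr).resolve_left two_ne_zero
    apply hX0
    rw [hXμ, hμ0, zero_smul, neg_zero]
  obtain ⟨j, hj⟩ := exists_col_ne_zero hW0
  refine ⟨W.col j, hj, ?_⟩
  have hXW : X * W = μ • W := by
    rw [hW, mul_add, hμ, mul_smul_comm, mul_one, smul_add, smul_smul]
    abel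
  rw [mulVec_col_eq, hXW]
  ext i
  simp [Matrix.col]

/-- **Columns of a singular `2 × 2` matrix are proportional**: if `det Z = 0` and the column
`v = Z eⱼ` is nonzero, then `Z w ∈ F v` for every `w`. [folklore] -/
theorem exists_mulVec_eq_smul_col_of_det_eq_zero {Z : Matrix (Fin 2) (Fin 2) F} (hZ : Z.det = 0)
    {j : Fin 2} (hj : Z.col j ≠ 0) (w : Fin 2 → F) : ∃ c : F, Z *ᵥ w = c • Z.col j := by
  -- every column is a multiple of column `j`
  have hcol : ∀ k : Fin 2, ∃ t : F, Z.col k = t • Z.col j := by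
    intro k
    by_cases hkj : k = j
    · exact ⟨1, by rw [hkj, one_smul]⟩
    rw [Matrix.det_fin_two] at hZ
    -- the `2 × 2` minor condition, whichever of `j, k` is `0`
    have hdet : Z 0 j * Z 1 k - Z 1 j * Z 0 k = 0 := by
      fin_cases j <;> fin_cases k
      · exact absurd rfl hkj
      · simp only [Fin.zero_eta, Fin.mk_one, Fin.isValue]
        linear_combination hZ
      · simp only [Fin.zero_eta, Fin.mk_one, Fin.isValue]
        linear_combination -hZ
      · exact absurd rfl hkj
    by_cases hp : Z 0 j ≠ 0
    · refine ⟨Z 0 k / Z 0 j, ?_⟩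
      ext i
      fin_cases i
      · simp [Matrix.col]; field_simp
      · simp [Matrix.col]; field_simp; linear_combination hdet
    · push Not at hp
      have hq : Z 1 j ≠ 0 := by
        intro hq
        apply hj
        ext i
        fin_cases i
        · simpa [Matrix.col] using hp
        · simpa [Matrix.col] using hq
      have hr : Z 0 k = 0 := by
        have : Z 1 j * Z 0 k = 0 := by linear_combination -hdet + Z 1 k * hp
        exact (mul_eq_zero.1 this).resolve_left hq
      refine ⟨Z 1 k / Z 1 j, ?_⟩
      ext i
      fin_cases i
      · simp [Matrix.col, hp, hr]
      · simp [Matrix.col]; field_simp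
  obtain ⟨t0, ht0⟩ := hcol 0
  obtain ⟨t1, ht1⟩ := hcol 1
  refine ⟨w 0 * t0 + w 1 * t1, ?_⟩
  have h0 : ∀ i, Z i 0 = t0 * Z i j := fun i ↦ by
    simpa [Matrix.col, Matrix.transpose_apply] using congrFun ht0 i
  have h1 : ∀ i, Z i 1 = t1 * Z i j := fun i ↦ by
    simpa [Matrix.col, Matrix.transpose_apply] using congrFun ht1 i
  ext i
  simp only [Matrix.mulVec, dotProduct, Fin.sum_univ_two, Pi.smul_apply, smul_eq_mul, Matrix.col,
    Matrix.transpose_apply]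
  rw [h0 i, h1 i]
  ring

/-- Semi-invariance under `ad` of a non-nilpotent trace-free `Z` is invariance: if `Z² = δ · 1`
with `δ ≠ 0` and `[X, Z] = q Z` then `q = 0` (multiply by `Z` on either side and add:
`2 q δ = 0`). [folklore] -/
theorem eq_zero_of_bracket_eq_smul [CharZero F] {X Z : Matrix (Fin 2) (Fin 2) F} {δ q : F} (hδ : δ ≠ 0)
    (hZ : Z * Z = δ • (1 : Matrix (Fin 2) (Fin 2) F)) (h : X * Z - Z * X = q • Z) : q = 0 := by
  have key : (X * Z - Z * X) * Z + Z * (X * Z - Z * X) = (q * δ + q * δ) • (1 : Matrix (Fin 2) (Fin 2) F) := by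
    rw [h, smul_mul_assoc, mul_smul_comm, hZ, smul_smul, ← add_smul]
  have key2 : (X * Z - Z * X) * Z + Z * (X * Z - Z * X) = 0 := by
    have e : (X * Z - Z * X) * Z + Z * (X * Z - Z * X) = X * (Z * Z) - (Z * Z) * X := by noncomm_ring
    rw [e, hZ, mul_smul_comm, smul_mul_assoc, mul_one, one_mul, sub_self]
  rw [key2] at key
  have h00 := congrFun (congrFun key 0) 0
  simp only [Matrix.zero_apply, Matrix.smul_apply, Matrix.one_apply_eq, smul_eq_mul, mul_one] at h00
  have h2 : (2 : F) * (q * δ) = 0 := by rw [two_mul]; exact h00.symm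
  simpa [hδ] using h2

/-! ### Lie subalgebras of `𝔰𝔩₂` -/

/-- Three linearly independent trace-free `2 × 2` matrices span `𝔰𝔩₂`: every trace-free matrix is
in their span (dimension count: `dim 𝔰𝔩₂ = 3`). [folklore] -/
theorem mem_span_of_linearIndependent_of_trace_eq_zero {v : Fin 3 → Matrix (Fin 2) (Fin 2) F}
    (hv : LinearIndependent F v) (htr : ∀ i, (v i).trace = 0) {T : Matrix (Fin 2) (Fin 2) F}
    (hT : T.trace = 0) : T ∈ Submodule.span F (Set.range v) := by
  set sl2 : Submodule F (Matrix (Fin 2) (Fin 2) F) := LinearMap.ker (Matrix.traceLinearMap (Fin 2) F F) with hsl2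
  have hle : Submodule.span F (Set.range v) ≤ sl2 := by
    rw [Submodule.span_le]
    rintro _ ⟨i, rfl⟩
    simp [hsl2, htr i]
  have hfin : Module.finrank F sl2 = 3 := by
    have h := LinearMap.finrank_range_add_finrank_ker (Matrix.traceLinearMap (Fin 2) F F)
    have hr : LinearMap.range (Matrix.traceLinearMap (Fin 2) F F) = ⊤ := by
      rw [LinearMap.range_eq_top]
      intro c
      refine ⟨Matrix.diagonal ![c, 0], ?_⟩
      simp [Matrix.trace, Fin.sum_univ_two]
    rw [hr, finrank_top, Module.finrank_self, Module.finrank_matrix, Module.finrank_self, Fintype.card_fin] at h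
    rw [hsl2]
    omega
  have hspan : Module.finrank F (Submodule.span F (Set.range v)) = 3 := by
    rw [finrank_span_eq_card hv, Fintype.card_fin]
  have heq : Submodule.span F (Set.range v) = sl2 :=
    Submodule.eq_of_le_of_finrank_eq hle (by rw [hspan, hfin])
  rw [heq]
  simp [hsl2, hT]

/-- **Lie subalgebras of `𝔰𝔩₂(F)` other than `𝔰𝔩₂(F)` have an invariant line** over any extension
`E ⊇ F` containing square roots of all elements of `F` (characteristic `0`).  Here `L` is an
`F`-subspace of trace-free matrices closed under the bracket and not containing all of
`E₁₂, E₂₁, H`. [folklore] -/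
theorem exists_eigenline_of_trace_eq_zero [CharZero F] {E : Type*} [Field E] [Algebra F E]
    (hsq : ∀ d : F, ∃ μ : E, μ * μ = algebraMap F E d)
    (L : Submodule F (Matrix (Fin 2) (Fin 2) F)) (htr : ∀ X ∈ L, X.trace = 0)
    (hL : ∀ X ∈ L, ∀ Y ∈ L, X * Y - Y * X ∈ L)
    (hne : ¬ ((!![0, 1; 0, 0] : Matrix (Fin 2) (Fin 2) F) ∈ L ∧ (!![0, 0; 1, 0] : Matrix (Fin 2) (Fin 2) F) ∈ L ∧
      (!![1, 0; 0, -1] : Matrix (Fin 2) (Fin 2) F) ∈ L)) :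
    ∃ v : Fin 2 → E, v ≠ 0 ∧ ∀ X ∈ L, ∃ c : E, (X.map (algebraMap F E)) *ᵥ v = c • v := by
  have hinj : Function.Injective (algebraMap F E) := (algebraMap F E).injective
  -- transport of vectors and of eigen-equations from `F` to `E`
  have lift : ∀ {v : Fin 2 → F}, v ≠ 0 → (∀ X ∈ L, ∃ c : F, X *ᵥ v = c • v) →
      ∃ w : Fin 2 → E, w ≠ 0 ∧ ∀ X ∈ L, ∃ c : E, (X.map (algebraMap F E)) *ᵥ w = c • w := by
    intro v hv hvL
    refine ⟨fun i ↦ algebraMap F E (v i), ?_, fun X hX ↦ ?_⟩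
    · intro h0
      apply hv
      ext i
      exact hinj (by simpa using congrFun h0 i)
    · obtain ⟨c, hc⟩ := hvL X hX
      refine ⟨algebraMap F E c, ?_⟩
      ext i
      have := congrFun hc i
      simp only [Matrix.mulVec, dotProduct, Pi.smul_apply, smul_eq_mul] at this ⊢
      simp only [Matrix.map_apply, ← map_mul, ← map_sum, this]
  -- Case `L = 0`
  by_cases h0 : ∀ X ∈ L, X = 0
  · refine lift (v := ![1, 0]) (by simp) fun X hX ↦ ⟨0, ?_⟩
    rw [h0 X hX, Matrix.zero_mulVec, zero_smul]
  push Not at h0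
  obtain ⟨X₀, hX₀L, hX₀⟩ := h0
  -- Case `L = F X₀`: an eigenvector of `X₀` over `E`
  by_cases h1 : ∀ Y ∈ L, ∃ t : F, Y = t • X₀
  · obtain ⟨μ, hμ⟩ := hsq (-X₀.det)
    set X₀' : Matrix (Fin 2) (Fin 2) E := X₀.map (algebraMap F E) with hX₀'
    haveI : CharZero E := charZero_of_injective_algebraMap hinj
    have htr' : X₀'.trace = 0 := by
      have h := htr X₀ hX₀L
      rw [Matrix.trace_fin_two] at h
      rw [hX₀', Matrix.trace_fin_two]
      simp only [Matrix.map_apply, ← map_add, h, map_zero]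
    have hne' : X₀' ≠ 0 := by
      intro h
      apply hX₀
      ext i j
      exact hinj (by simpa [hX₀'] using congrFun (congrFun h i) j)
    have hsq' : X₀' * X₀' = (μ * μ) • (1 : Matrix (Fin 2) (Fin 2) E) := by
      rw [hX₀', ← Matrix.map_mul, mul_self_eq_smul_one_of_trace_eq_zero X₀ (htr X₀ hX₀L),
        Matrix.map_smul' _ _ _ (map_mul (algebraMap F E)), Matrix.map_one _ (map_zero _) (map_one _), ← hμ]
    obtain ⟨v, hv, hXv⟩ := exists_mulVec_eq_smul_of_mul_self_eq htr' hne' hsq'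
    refine ⟨v, hv, fun Y hY ↦ ?_⟩
    obtain ⟨t, rfl⟩ := h1 Y hY
    refine ⟨algebraMap F E t * μ, ?_⟩
    rw [Matrix.map_smul' _ _ _ (map_mul _), ← hX₀', Matrix.smul_mulVec, hXv, smul_smul]
  push Not at h1
  obtain ⟨Y₀, hY₀L, hY₀⟩ := h1
  -- Case `L = F X₀ ⊕ F Y₀`
  by_cases h2 : ∀ W ∈ L, ∃ p q : F, W = p • X₀ + q • Y₀
  · set Z : Matrix (Fin 2) (Fin 2) F := X₀ * Y₀ - Y₀ * X₀ with hZ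
    have hZL : Z ∈ L := hL X₀ hX₀L Y₀ hY₀L
    obtain ⟨p, q, hZpq⟩ := h2 Z hZL
    have hZ0 : Z ≠ 0 := by
      intro hZ0
      obtain ⟨t, ht⟩ := exists_eq_smul_of_commute_of_trace_eq_zero (htr X₀ hX₀L) (htr Y₀ hY₀L) hX₀
        (sub_eq_zero.1 (hZ ▸ hZ0))
      exact hY₀ t ht
    have hXZ : X₀ * Z - Z * X₀ = q • Z := by
      have : X₀ * Z - Z * X₀ = q • (X₀ * Y₀ - Y₀ * X₀) := by
        conv_lhs => rw [hZpq]
        simp only [mul_add, add_mul, mul_smul_comm, smul_mul_assoc, smul_sub]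
        abel
      rw [this, ← hZ]
    have hYZ : Y₀ * Z - Z * Y₀ = (-p) • Z := by
      have : Y₀ * Z - Z * Y₀ = (-p) • (X₀ * Y₀ - Y₀ * X₀) := by
        conv_lhs => rw [hZpq]
        simp only [mul_add, add_mul, mul_smul_comm, smul_mul_assoc, smul_sub, neg_smul]
        abel
      rw [this, ← hZ]
    have hZtr : Z.trace = 0 := htr Z hZL
    have hZsq := mul_self_eq_smul_one_of_trace_eq_zero Z hZtr
    -- `Z` is nilpotent
    have hdet : Z.det = 0 := by
      by_contra hδ
      have hq : q = 0 := eq_zero_of_bracket_eq_smul (neg_ne_zero.2 hδ) hZsq hXZ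
      have hp : -p = 0 := eq_zero_of_bracket_eq_smul (neg_ne_zero.2 hδ) hZsq hYZ
      apply hZ0
      rw [hZpq, hq, neg_eq_zero.1 hp, zero_smul, zero_smul, add_zero]
    rw [hdet, neg_zero, zero_smul] at hZsq
    obtain ⟨j, hj⟩ := exists_col_ne_zero hZ0
    -- the kernel line `F (Z eⱼ)` is invariant
    have hX₀v : ∃ c : F, X₀ *ᵥ Z.col j = c • Z.col j := by
      obtain ⟨c, hc⟩ := exists_mulVec_eq_smul_col_of_det_eq_zero hdet hj (X₀.col j)
      refine ⟨c + q, ?_⟩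
      have e : X₀ * Z = Z * X₀ + q • Z := by rw [← hXZ]; abel
      rw [mulVec_col_eq, e]
      have : (Z * X₀ + q • Z).col j = Z *ᵥ X₀.col j + q • Z.col j := by
        rw [mulVec_col_eq]; ext i
        simp only [Matrix.col, Matrix.transpose_apply, Matrix.add_apply, Matrix.smul_apply, Pi.add_apply,
          Pi.smul_apply]
      rw [this, hc, add_smul]
    have hY₀v : ∃ c : F, Y₀ *ᵥ Z.col j = c • Z.col j := by
      obtain ⟨c, hc⟩ := exists_mulVec_eq_smul_col_of_det_eq_zero hdet hj (Y₀.col j)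
      refine ⟨c + -p, ?_⟩
      have e : Y₀ * Z = Z * Y₀ + (-p) • Z := by rw [← hYZ]; abel
      rw [mulVec_col_eq, e]
      have : (Z * Y₀ + (-p) • Z).col j = Z *ᵥ Y₀.col j + (-p) • Z.col j := by
        rw [mulVec_col_eq]; ext i
        simp only [Matrix.col, Matrix.transpose_apply, Matrix.add_apply, Matrix.smul_apply, Pi.add_apply,
          Pi.smul_apply]
      rw [this, hc, add_smul]
    refine lift hj fun W hW ↦ ?_
    obtain ⟨a, b, rfl⟩ := h2 W hW
    obtain ⟨c, hc⟩ := hX₀v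
    obtain ⟨d, hd⟩ := hY₀v
    refine ⟨a * c + b * d, ?_⟩
    rw [Matrix.add_mulVec, Matrix.smul_mulVec, Matrix.smul_mulVec, hc, hd, smul_smul, smul_smul,
      ← add_smul]
  -- Case of three independent elements: `L ⊇ 𝔰𝔩₂`, excluded
  exfalso
  push Not at h2
  obtain ⟨W, hWL, hW⟩ := h2
  have hli : LinearIndependent F ![W, Y₀, X₀] := by
    have h2' : LinearIndependent F ![Y₀, X₀] := by
      rw [linearIndependent_fin2]
      refine ⟨hX₀, fun a ha ↦ hY₀ a ?_⟩
      exact ha.symm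
    have h3 : W ∉ Submodule.span F (Set.range ![Y₀, X₀]) := by
      intro hmem
      rw [Matrix.range_cons, Matrix.range_cons, Matrix.range_empty, Set.union_empty,
        Set.singleton_union, Submodule.mem_span_pair] at hmem
      obtain ⟨a, b, hab⟩ := hmem
      exact hW b a (by rw [← hab]; abel)
    exact linearIndependent_finCons.2 ⟨h2', h3⟩
  have htr3 : ∀ i, (![W, Y₀, X₀] i).trace = 0 := by
    intro i
    fin_cases i
    · exact htr W hWL
    · exact htr Y₀ hY₀L
    · exact htr X₀ hX₀L
  have hsub : Submodule.span F (Set.range ![W, Y₀, X₀]) ≤ L := by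
    rw [Submodule.span_le]
    rintro _ ⟨i, rfl⟩
    fin_cases i
    · exact hWL
    · exact hY₀L
    · exact hX₀L
  apply hne
  refine ⟨hsub (mem_span_of_linearIndependent_of_trace_eq_zero hli htr3 ?_),
    hsub (mem_span_of_linearIndependent_of_trace_eq_zero hli htr3 ?_),
    hsub (mem_span_of_linearIndependent_of_trace_eq_zero hli htr3 ?_)⟩ <;>
    simp [Matrix.trace_fin_two]

/-- **Lie subalgebras of `𝔤𝔩₂(F)` not containing `𝔰𝔩₂(F)` have an invariant line** over any
extension `E ⊇ F` containing square roots of all elements of `F` (characteristic `0`): reduce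
to the trace-free part `π(L)`, `π(X) = X − ½ tr(X) · 1`, which has the same invariant lines, is
again closed under the bracket, and contains `E₁₂, E₂₁, H` only if `L` does
(`E₁₂ = ½ [H, E₁₂]`, `E₂₁ = −½ [H, E₂₁]`, `H = [E₁₂, E₂₁]`). [folklore] -/
theorem exists_eigenline_of_not_sl2_subset [CharZero F] {E : Type*} [Field E] [Algebra F E]
    (hsq : ∀ d : F, ∃ μ : E, μ * μ = algebraMap F E d)
    (L : Submodule F (Matrix (Fin 2) (Fin 2) F)) (hL : ∀ X ∈ L, ∀ Y ∈ L, X * Y - Y * X ∈ L)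
    (hne : ¬ ((!![0, 1; 0, 0] : Matrix (Fin 2) (Fin 2) F) ∈ L ∧ (!![0, 0; 1, 0] : Matrix (Fin 2) (Fin 2) F) ∈ L ∧
      (!![1, 0; 0, -1] : Matrix (Fin 2) (Fin 2) F) ∈ L)) :
    ∃ v : Fin 2 → E, v ≠ 0 ∧ ∀ X ∈ L, ∃ c : E, (X.map (algebraMap F E)) *ᵥ v = c • v := by
  -- the projection to the trace-free part
  set π : Matrix (Fin 2) (Fin 2) F →ₗ[F] Matrix (Fin 2) (Fin 2) F :=
    LinearMap.id - (2⁻¹ : F) • (Matrix.traceLinearMap (Fin 2) F F).smulRight 1 with hπ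
  have hπapp : ∀ X, π X = X - ((2⁻¹ : F) * X.trace) • (1 : Matrix (Fin 2) (Fin 2) F) := by
    intro X
    simp [hπ, smul_smul]
  have h2 : (2 : F) ≠ 0 := two_ne_zero
  have hπtr : ∀ X, (π X).trace = 0 := by
    intro X
    rw [hπapp, Matrix.trace_sub, Matrix.trace_smul, Matrix.trace_one, Fintype.card_fin]
    simp only [Nat.cast_ofNat, smul_eq_mul]
    field_simp
    ring
  have hπfix : ∀ X : Matrix (Fin 2) (Fin 2) F, X.trace = 0 → π X = X := by
    intro X hX
    rw [hπapp, hX, mul_zero, zero_smul, sub_zero]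
  have hbr : ∀ X Y : Matrix (Fin 2) (Fin 2) F, π X * π Y - π Y * π X = X * Y - Y * X := by
    intro X Y
    rw [hπapp, hπapp]
    simp only [mul_sub, sub_mul, mul_smul_comm, smul_mul_assoc, mul_one, one_mul]
    module
  set L' : Submodule F (Matrix (Fin 2) (Fin 2) F) := L.map π with hL'
  have htr' : ∀ X ∈ L', X.trace = 0 := by
    rintro _ ⟨X, hX, rfl⟩
    exact hπtr X
  have hL'br : ∀ X ∈ L', ∀ Y ∈ L', X * Y - Y * X ∈ L' := by
    rintro _ ⟨X, hX, rfl⟩ _ ⟨Y, hY, rfl⟩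
    rw [hbr]
    refine ⟨X * Y - Y * X, hL X hX Y hY, hπfix _ ?_⟩
    rw [Matrix.trace_sub, Matrix.trace_mul_comm, sub_self]
  have hne' : ¬ ((!![0, 1; 0, 0] : Matrix (Fin 2) (Fin 2) F) ∈ L' ∧ (!![0, 0; 1, 0] : Matrix (Fin 2) (Fin 2) F) ∈ L' ∧
      (!![1, 0; 0, -1] : Matrix (Fin 2) (Fin 2) F) ∈ L') := by
    rintro ⟨⟨Xe, hXe, he⟩, ⟨Xf, hXf, hf⟩, ⟨Xh, hXh, hh⟩⟩
    -- `[X_h, X_e] = [H, E] = 2 E`, etc.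
    have hHE : Xh * Xe - Xe * Xh = (2 : F) • (!![0, 1; 0, 0] : Matrix (Fin 2) (Fin 2) F) := by
      rw [← hbr, hh, he]
      ext i j; fin_cases i <;> fin_cases j <;> simp
      all_goals norm_num
    have hHF : Xh * Xf - Xf * Xh = (-2 : F) • (!![0, 0; 1, 0] : Matrix (Fin 2) (Fin 2) F) := by
      rw [← hbr, hh, hf]
      ext i j; fin_cases i <;> fin_cases j <;> simp
      all_goals norm_num
    have heL : (!![0, 1; 0, 0] : Matrix (Fin 2) (Fin 2) F) ∈ L := by
      have h := L.smul_mem (2⁻¹ : F) (hL Xh hXh Xe hXe)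
      rwa [hHE, smul_smul, inv_mul_cancel₀ h2, one_smul] at h
    have hfL : (!![0, 0; 1, 0] : Matrix (Fin 2) (Fin 2) F) ∈ L := by
      have h := L.smul_mem ((-2)⁻¹ : F) (hL Xh hXh Xf hXf)
      rwa [hHF, smul_smul, inv_mul_cancel₀ (by norm_num), one_smul] at h
    have hhL : (!![1, 0; 0, -1] : Matrix (Fin 2) (Fin 2) F) ∈ L := by
      have h := hL _ heL _ hfL
      have e : (!![0, 1; 0, 0] : Matrix (Fin 2) (Fin 2) F) * !![0, 0; 1, 0] - !![0, 0; 1, 0] * !![0, 1; 0, 0] =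
          !![1, 0; 0, -1] := by
        ext i j; fin_cases i <;> fin_cases j <;> simp
      rwa [e] at h
    exact hne ⟨heL, hfL, hhL⟩
  obtain ⟨v, hv, hvL'⟩ := exists_eigenline_of_trace_eq_zero hsq L' htr' hL'br hne'
  refine ⟨v, hv, fun X hX ↦ ?_⟩
  obtain ⟨c, hc⟩ := hvL' (π X) ⟨X, hX, rfl⟩
  refine ⟨c + algebraMap F E (2⁻¹ * X.trace), ?_⟩
  have hX : X = π X + ((2⁻¹ : F) * X.trace) • (1 : Matrix (Fin 2) (Fin 2) F) := by
    rw [hπapp, sub_add_cancel]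
  conv_lhs => rw [hX]
  rw [Matrix.map_add _ (map_add _), Matrix.add_mulVec, hc, Matrix.map_smul' _ _ _ (map_mul _),
    Matrix.map_one _ (map_zero _) (map_one _), Matrix.smul_mulVec, Matrix.one_mulVec, add_smul]

end OpenImage

end Literature.NumberTheory.EllipticCurves.ModularForms
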